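import Summits.BirchSwinnertonDyer.BirchSwinnertonDyer.Theorems.SignedLowerHalvesSprungLowerDivisibilityAtThreeCokerBoundByMassSkeleton
import HarnessLib

/-!
# Crux `SprungLowerDivisibilityAtThree` (item stmt-BirchSwinnertonDyer-19875; twin route `PrintX8VSC`, held pack
# `HeldFactsIotaDoorX8Contra` = item 23731), line `chromatic-common-zeros`: the MASS SKELETON WITHOUT A CYCLIC `𝐇¹` —
# `𝔭`-LOCAL cyclicity suffices (pure module algebra; this is what removes Kato's Thm. 12.4 (3) «`𝐇¹` free of rank one»
# from the `ι`-door pack, see the companion `…CokerBoundByMassPoitouTateOfColMap.lean`)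

Cell `bsd-ssimc` (host), width seat `cruxlead-stmt-BirchSwinnertonDyer-19875-w3` (gen 10) under the 19875 LEAD; `--supports`
stmt-BirchSwinnertonDyer-19875 `--as helper`; theorems only, generic commutative algebra over a ring `R` (no arithmetic object);
closes NO item. Companion of `…CokerBoundByMassSkeleton.lean` (w2 g9, p-landed: `min_lengthAt_le_fine_add_torsion_of_massSkeleton`, the
algebra behind (M1) «`min(ℓ_𝔭 X♯, ℓ_𝔭 X♭) ≤ ℓ_𝔭 X₀ + ℓ_𝔭 tors X`», whose source module `H` (read: Kato's `𝐇¹`) is assumed CYCLIC,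
`H = R·h₀` — the one place where the `ι`-door consumes `Kato2004.thm12_4` (3)).

THE POINT. The skeleton concludes an inequality of local lengths AT ONE height-one prime `𝔭`, and its two uses of cyclicity
(`lengthAt_quotient_ker_sup_range_eq`: `c(loc H) = (c(loc h₀))`; `lengthAt_torsion_pair_quotient_le_torsion`: `J(loc H) = R·J(loc h₀)`)
only serve to identify two submodules whose difference is invisible at `𝔭` as soon as `H` is cyclic UP TO AN ELEMENT `s ∉ 𝔭`:
`∀ h, ∃ r, s·h = r·h₀`. Then `(c(loc h₀)) ⊆ c(loc H)` and `R·J(loc h₀) ⊆ J(loc H)` with both quotients killed by `s`, hence of length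
`0` at `𝔭` (`lengthAt_eq_zero_of_isTorsionBy`), and the skeleton goes through verbatim. Finally, `𝔭`-local cyclicity is AUTOMATIC for a
finitely generated… indeed for ANY non-zero submodule `H ↪ R` of a UFD `R` at a height-one prime `𝔭 = (π)`: take `a₀ ∈ H` of least
`π`-multiplicity `v` among the non-zero elements, `a₀ = π^v·s` with `π ∤ s`; every `x = π^n·y ∈ H` (`n ≥ v`) has `s·x = (π^{n−v}·y)·a₀`.

* §1 `lengthAt_quotient_ker_sup_range_eq_quotient_range` (no cyclicity at all: `ℓ_𝔭 P/(ker c ⊔ loc H) = ℓ_𝔭 R/c(loc H)`),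
  `lengthAt_quotient_ker_sup_range_eq_of_smul` (the `𝔭`-local form of w2's lemma), `lengthAt_torsion_quotient_map_le_torsion`
  (no cyclicity: `ℓ_𝔭 tors(R²/J(loc H)) ≤ ℓ_𝔭 tors X`), `lengthAt_torsion_span_quotient_le_torsion_of_smul` (the `𝔭`-local form).
* §2 `min_lengthAt_le_fine_add_torsion_of_massSkeleton_of_smul` — THE MASS SKELETON with `hcyc` replaced by
  `hs : s ∉ 𝔭`, `hcyc : ∀ h, ∃ r, s • h = r • h₀`.
* §3 `exists_smul_cyclic_of_injective` — over a UFD, an `R`-module `H` with an INJECTIVE linear map `H → R` and `H ≠ 0` is `𝔭`-locally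
  cyclic at every height-one `𝔭`, on a generator `h₀ ≠ 0`.

HONEST FRAMING: module algebra only; nothing about any curve; K′, C′, K1, BSD untouched. References: [BourbakiAC5to7] VII §4.4–4.5 (lengths
at height-one primes, pseudo-null modules); [Washington1997] §13.2; tree `…CokerBoundByMassSkeleton` (w2 g9), `…CokerBoundSkeleton`
(`lengthAt_eq_of_le_of_smul_le`), `IwasawaAlgebraProofs` (`lengthAt_eq_zero_of_isTorsionBy`).
-/

set_option linter.dupNamespace false
set_option autoImplicit false

noncomputable section

open scoped Classical

open Literature.NumberTheory.EllipticCurves Literature.NumberTheory.EllipticCurves.Module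
  Summit.BirchSwinnertonDyer.BirchSwinnertonDyer.Theorems.SmallImageSignedMuDefect

namespace Summit.BirchSwinnertonDyer.BirchSwinnertonDyer.Theorems.ChromaticCommonZeros

/-! ### §1 The two cyclicity lemmas of the skeleton, `𝔭`-locally -/

section LocalAlgebra

variable {R : Type*} [CommRing R]
  {H P X : Type*} [AddCommGroup H] [Module R H] [AddCommGroup P] [Module R P] [AddCommGroup X] [Module R X]

/-- A module killed by some `s ∉ 𝔭` has length `0` at `𝔭` — submodule-quotient form: if `A ≤ B ≤ M` and `s·B ⊆ A` with `s ∉ 𝔭`, then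
`ℓ_𝔭(B/A) = 0` (here for the image `B.map A.mkQ` of `B` in `M/A`). [folklore] [cite: BourbakiAC5to7, VII §4.4] -/
theorem lengthAt_map_mkQ_eq_zero_of_smul_le {M : Type*} [AddCommGroup M] [Module R M] (A B : Submodule R M) {s : R}
    (𝔭 : PrimeSpectrum R) (hs : s ∉ 𝔭.asIdeal) (hsB : ∀ x ∈ B, s • x ∈ A) :
    Module.lengthAt R (B.map A.mkQ) 𝔭 = 0 := by
  refine lengthAt_eq_zero_of_isTorsionBy (s := s) ?_ 𝔭 hs
  rintro ⟨q, hq⟩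
  obtain ⟨x, hx, rfl⟩ := Submodule.mem_map.mp hq
  apply Subtype.ext
  change s • A.mkQ x = 0
  rw [← map_smul, Submodule.mkQ_apply, Submodule.Quotient.mk_eq_zero]
  exact hsB x hx

/-- **`ℓ_𝔭 P/(ker c ⊔ range loc) = ℓ_𝔭 R/c(range loc)`** for a functional `c : P → R` whose cokernel has length `0` at `𝔭` — NO
hypothesis on `H`: `c` identifies `P/(ker c ⊔ loc H)` with `c(P)/c(loc H) ⊆ R/c(loc H)`, of colength `ℓ_𝔭(R/c(P)) = 0`. (w2 g9's
`lengthAt_quotient_ker_sup_range_eq` is the case `H = R·h₀`, `c(loc H) = (c(loc h₀))`.) [folklore] [cite: Sprung2012, §7.1 Props. 7.3/7.6 (pp. 1500–1501)] -/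
theorem lengthAt_quotient_ker_sup_range_eq_quotient_range (loc : H →ₗ[R] P) (c : P →ₗ[R] R) (𝔭 : PrimeSpectrum R)
    (hc : Module.lengthAt R (R ⧸ LinearMap.range c) 𝔭 = 0) :
    Module.lengthAt R (P ⧸ (LinearMap.ker c ⊔ LinearMap.range loc)) 𝔭 =
      Module.lengthAt R (R ⧸ LinearMap.range (c ∘ₗ loc)) 𝔭 := by
  set I : Submodule R R := LinearMap.range (c ∘ₗ loc) with hI
  -- `φ = mk ∘ c : P → R/I` has kernel `ker c ⊔ range loc`
  set φ : P →ₗ[R] R ⧸ I := I.mkQ ∘ₗ c with hφ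
  have hkerφ : LinearMap.ker φ = LinearMap.ker c ⊔ LinearMap.range loc := by
    apply le_antisymm
    · intro z hz
      rw [LinearMap.mem_ker, hφ, LinearMap.comp_apply, Submodule.mkQ_apply, Submodule.Quotient.mk_eq_zero, hI] at hz
      obtain ⟨h, hh⟩ := LinearMap.mem_range.mp hz
      rw [LinearMap.comp_apply] at hh
      have hz' : z - loc h ∈ LinearMap.ker c := by
        rw [LinearMap.mem_ker, map_sub, hh, sub_self]
      have : z = (z - loc h) + loc h := by abel
      rw [this]
      exact Submodule.add_mem_sup hz' (LinearMap.mem_range_self loc h)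
    · refine sup_le (fun z hz => ?_) ?_
      · rw [LinearMap.mem_ker] at hz
        rw [LinearMap.mem_ker, hφ, LinearMap.comp_apply, hz, map_zero]
      · rintro _ ⟨h, rfl⟩
        rw [LinearMap.mem_ker, hφ, LinearMap.comp_apply, Submodule.mkQ_apply, Submodule.Quotient.mk_eq_zero, hI]
        exact ⟨h, rfl⟩
  -- `range φ = (range c).map mk`, and `(R/I) / range φ ≅ R / range c`
  have hIle : I ≤ LinearMap.range c := by
    rw [hI, LinearMap.range_comp]
    exact LinearMap.map_le_range
  have hrange : LinearMap.range φ = (LinearMap.range c).map I.mkQ := by rw [hφ, LinearMap.range_comp]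
  have h1 := lengthAt_eq_add_quotient (LinearMap.range φ) 𝔭
  rw [← lengthAt_eq_of_linearEquiv φ.quotKerEquivRange 𝔭, hkerφ, hrange,
    lengthAt_eq_of_linearEquiv (Submodule.quotientQuotientEquivQuotient I (LinearMap.range c) hIle) 𝔭, hc,
    add_zero] at h1
  exact h1.symm

/-- **`𝔭`-LOCAL form of `lengthAt_quotient_ker_sup_range_eq`: `ℓ_𝔭 P/(ker c ⊔ range loc) = ℓ_𝔭 R/(c(loc h₀))`** as soon as `H` is
cyclic on `h₀` up to an element `s ∉ 𝔭` (`∀ h, ∃ r, s·h = r·h₀`) and `coker c` has length `0` at `𝔭`: `(c(loc h₀)) ⊆ c(loc H)` with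
quotient killed by `s`, so `ℓ_𝔭 R/(c(loc h₀)) = 0 + ℓ_𝔭 R/c(loc H)`. [folklore] [cite: BourbakiAC5to7, VII §4.4] -/
theorem lengthAt_quotient_ker_sup_range_eq_of_smul (loc : H →ₗ[R] P) (c : P →ₗ[R] R) (h₀ : H) {s : R}
    (𝔭 : PrimeSpectrum R) (hs : s ∉ 𝔭.asIdeal) (hcyc : ∀ h : H, ∃ r : R, s • h = r • h₀)
    (hc : Module.lengthAt R (R ⧸ LinearMap.range c) 𝔭 = 0) :
    Module.lengthAt R (P ⧸ (LinearMap.ker c ⊔ LinearMap.range loc)) 𝔭 =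
      Module.lengthAt R (R ⧸ Ideal.span {c (loc h₀)}) 𝔭 := by
  rw [lengthAt_quotient_ker_sup_range_eq_quotient_range loc c 𝔭 hc]
  set I : Submodule R R := LinearMap.range (c ∘ₗ loc) with hI
  set A : Submodule R R := Ideal.span {c (loc h₀)} with hA
  have hAI : A ≤ I := by
    rw [hA, Ideal.span_singleton_le_iff_mem, hI]
    exact ⟨h₀, rfl⟩
  have hsI : ∀ y ∈ I, s • y ∈ A := by
    rintro _ ⟨h, rfl⟩
    obtain ⟨r, hr⟩ := hcyc h
    rw [LinearMap.comp_apply, ← map_smul, ← map_smul, hr, map_smul, map_smul, hA]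
    exact Ideal.mul_mem_left _ r (Ideal.mem_span_singleton_self _)
  -- `ℓ(R/A) = ℓ(I/A) + ℓ(R/I) = ℓ(R/I)`
  rw [lengthAt_eq_add_quotient (I.map A.mkQ) 𝔭, lengthAt_map_mkQ_eq_zero_of_smul_le A I 𝔭 hs hsI, zero_add,
    lengthAt_eq_of_linearEquiv (Submodule.quotientQuotientEquivQuotient A I hAI) 𝔭]

/-- **`ℓ_𝔭 tors(R²/J(loc H)) ≤ ℓ_𝔭 tors X`** (Poitou–Tate exact at `P`, `J` injective with cokernel of length `0` at `𝔭`) — NO hypothesis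
on `H`: `P/loc H ↪ R²/J(loc H)` with cokernel a quotient of `R²/range J`, and `P/loc H ≅ toX(P) ⊆ X`. (w2 g9's
`lengthAt_torsion_pair_quotient_le_torsion` is the case `H = R·h₀`.) [folklore] [cite: Kato2004Asterisque, (17.13.1) (p. 280)] -/
theorem lengthAt_torsion_quotient_map_le_torsion (loc : H →ₗ[R] P) (toX : P →ₗ[R] X) (hexact : Function.Exact loc toX)
    (J : P →ₗ[R] R × R) (hJ : Function.Injective J)
    (𝔭 : PrimeSpectrum R) (hcoker : Module.lengthAt R ((R × R) ⧸ LinearMap.range J) 𝔭 = 0) :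
    Module.lengthAt R (Submodule.torsion R ((R × R) ⧸ (LinearMap.range loc).map J)) 𝔭 ≤
      Module.lengthAt R (Submodule.torsion R X) 𝔭 := by
  set N : Submodule R (R × R) := (LinearMap.range loc).map J with hN
  have hcomap : N.comap J = LinearMap.range loc := by rw [hN, Submodule.comap_map_eq_of_injective hJ]
  have hle : LinearMap.range loc ≤ N.comap J := hcomap.ge
  set ψ : (P ⧸ LinearMap.range loc) →ₗ[R] (R × R) ⧸ N := Submodule.mapQ _ N J hle with hψ
  have hψinj : Function.Injective ψ := by
    rw [← LinearMap.ker_eq_bot, hψ, Submodule.ker_mapQ, hcomap, Submodule.mkQ_map_self]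
  have hψrange : LinearMap.range ψ = (LinearMap.range J).map N.mkQ := by
    rw [hψ]
    unfold Submodule.mapQ
    rw [Submodule.range_liftQ, LinearMap.range_comp]
  have hNle : N ≤ LinearMap.range J := by rw [hN]; exact LinearMap.map_le_range
  have hcoker' : Module.lengthAt R (((R × R) ⧸ N) ⧸ LinearMap.range ψ) 𝔭 = 0 := by
    rw [hψrange, lengthAt_eq_of_linearEquiv (Submodule.quotientQuotientEquivQuotient N _ hNle) 𝔭, hcoker]
  have hker : LinearMap.ker toX = LinearMap.range loc := LinearMap.exact_iff.mp hexact
  set g : (P ⧸ LinearMap.range loc) →ₗ[R] X := (LinearMap.range loc).liftQ toX hker.ge with hg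
  have hginj : Function.Injective g := by
    rw [← LinearMap.ker_eq_bot, hg]
    exact Submodule.ker_liftQ_eq_bot _ _ _ hker.le
  calc Module.lengthAt R (Submodule.torsion R ((R × R) ⧸ N)) 𝔭
      ≤ Module.lengthAt R (Submodule.torsion R (P ⧸ LinearMap.range loc)) 𝔭 +
          Module.lengthAt R (((R × R) ⧸ N) ⧸ LinearMap.range ψ) 𝔭 :=
        lengthAt_torsion_le_add_of_injective ψ hψinj 𝔭
    _ = Module.lengthAt R (Submodule.torsion R (P ⧸ LinearMap.range loc)) 𝔭 := by rw [hcoker', add_zero]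
    _ ≤ Module.lengthAt R (Submodule.torsion R X) 𝔭 := lengthAt_torsion_le_of_injective g hginj 𝔭

/-- The torsion submodule of `M/A` is no longer, at `𝔭`, than that of `M/B` when `A ≤ B` and `s·B ⊆ A` for some `s ∉ 𝔭`: the quotient
map `M/A ↠ M/B` restricted to torsion has kernel inside `B/A`, of length `0` at `𝔭`. [folklore] [cite: BourbakiAC5to7, VII §4.4] -/
theorem lengthAt_torsion_quotient_le_of_smul_le {M : Type*} [AddCommGroup M] [Module R M] (A B : Submodule R M) (hAB : A ≤ B)
    {s : R} (𝔭 : PrimeSpectrum R) (hs : s ∉ 𝔭.asIdeal) (hsB : ∀ x ∈ B, s • x ∈ A) :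
    Module.lengthAt R (Submodule.torsion R (M ⧸ A)) 𝔭 ≤ Module.lengthAt R (Submodule.torsion R (M ⧸ B)) 𝔭 := by
  -- the quotient map `q : M/A → M/B` and its restriction to torsion
  have hle : A ≤ B.comap (LinearMap.id : M →ₗ[R] M) := by rwa [Submodule.comap_id]
  set q : (M ⧸ A) →ₗ[R] M ⧸ B := Submodule.mapQ A B LinearMap.id hle with hq
  have hkerq : LinearMap.ker q = B.map A.mkQ := by
    rw [hq, Submodule.ker_mapQ, Submodule.comap_id]
  set TA := Submodule.torsion R (M ⧸ A) with hTA
  set f : TA →ₗ[R] M ⧸ B := q ∘ₗ TA.subtype with hf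
  -- `range f ≤ tors(M/B)`
  have hrange : ∀ t : TA, f t ∈ Submodule.torsion R (M ⧸ B) := by
    rintro ⟨t, ht⟩
    obtain ⟨a, ha⟩ := (Submodule.mem_torsion_iff t).mp ht
    refine (Submodule.mem_torsion_iff _).mpr ⟨a, ?_⟩
    rw [Submonoid.smul_def] at ha ⊢
    change (a : R) • q t = 0
    rw [← map_smul, ha, map_zero]
  set f' : TA →ₗ[R] Submodule.torsion R (M ⧸ B) := LinearMap.codRestrict _ f hrange with hf'
  -- `ℓ TA = ℓ ker f' + ℓ (TA / ker f') ≤ ℓ (B/A) + ℓ tors(M/B) = ℓ tors(M/B)`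
  have hkerle : Module.lengthAt R (LinearMap.ker f') 𝔭 ≤ Module.lengthAt R (B.map A.mkQ) 𝔭 := by
    have hsub : ∀ t : LinearMap.ker f', ((t : TA) : M ⧸ A) ∈ B.map A.mkQ := by
      rintro ⟨t, ht⟩
      rw [← hkerq, LinearMap.mem_ker]
      rw [LinearMap.mem_ker, hf'] at ht
      have := congrArg Subtype.val ht
      simpa [hf] using this
    set ι' : LinearMap.ker f' →ₗ[R] B.map A.mkQ :=
      { toFun := fun t => ⟨((t : TA) : M ⧸ A), hsub t⟩
        map_add' := fun x y => rfl
        map_smul' := fun r x => rfl } with hι'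
    refine lengthAt_le_of_injective ι' ?_ 𝔭
    rintro ⟨⟨x, hx⟩, hx'⟩ ⟨⟨y, hy⟩, hy'⟩ hxy
    have : x = y := congrArg Subtype.val hxy
    subst this
    rfl
  calc Module.lengthAt R TA 𝔭
      = Module.lengthAt R (LinearMap.ker f') 𝔭 + Module.lengthAt R (TA ⧸ LinearMap.ker f') 𝔭 :=
        lengthAt_eq_add_quotient _ 𝔭
    _ ≤ Module.lengthAt R (B.map A.mkQ) 𝔭 + Module.lengthAt R (Submodule.torsion R (M ⧸ B)) 𝔭 := by
        refine add_le_add hkerle (lengthAt_le_of_injective ((LinearMap.ker f').liftQ f' le_rfl) ?_ 𝔭)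
        rw [← LinearMap.ker_eq_bot]
        exact Submodule.ker_liftQ_eq_bot _ _ _ le_rfl
    _ = Module.lengthAt R (Submodule.torsion R (M ⧸ B)) 𝔭 := by
        rw [lengthAt_map_mkQ_eq_zero_of_smul_le A B 𝔭 hs hsB, zero_add]

/-- **`𝔭`-LOCAL form of `lengthAt_torsion_pair_quotient_le_torsion`: `ℓ_𝔭 tors(R²/R·J(loc h₀)) ≤ ℓ_𝔭 tors X`** as soon as `H` is cyclic
on `h₀` up to `s ∉ 𝔭` (Poitou–Tate exact at `P`, `J` injective with cokernel of length `0` at `𝔭`): `R·J(loc h₀) ⊆ J(loc H)` with quotient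
killed by `s`, then `lengthAt_torsion_quotient_map_le_torsion`. [folklore] [cite: Kato2004Asterisque, (17.13.1) (p. 280)]
[cite: KuriharaPollack2007, Prop. 1.2] -/
theorem lengthAt_torsion_span_quotient_le_torsion_of_smul (loc : H →ₗ[R] P) (toX : P →ₗ[R] X)
    (hexact : Function.Exact loc toX) (J : P →ₗ[R] R × R) (hJ : Function.Injective J) (h₀ : H) {s : R}
    (𝔭 : PrimeSpectrum R) (hs : s ∉ 𝔭.asIdeal) (hcyc : ∀ h : H, ∃ r : R, s • h = r • h₀)
    (hcoker : Module.lengthAt R ((R × R) ⧸ LinearMap.range J) 𝔭 = 0) :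
    Module.lengthAt R (Submodule.torsion R ((R × R) ⧸ Submodule.span R {J (loc h₀)})) 𝔭 ≤
      Module.lengthAt R (Submodule.torsion R X) 𝔭 := by
  set N : Submodule R (R × R) := (LinearMap.range loc).map J with hN
  set N₀ : Submodule R (R × R) := Submodule.span R {J (loc h₀)} with hN₀
  have hle : N₀ ≤ N := by
    rw [hN₀, Submodule.span_singleton_le_iff_mem, hN]
    exact ⟨loc h₀, LinearMap.mem_range_self loc h₀, rfl⟩
  have hsN : ∀ x ∈ N, s • x ∈ N₀ := by
    rintro _ ⟨_, ⟨h, rfl⟩, rfl⟩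
    obtain ⟨r, hr⟩ := hcyc h
    rw [← map_smul, ← map_smul, hr, map_smul, map_smul, hN₀]
    exact Submodule.smul_mem _ r (Submodule.mem_span_singleton_self _)
  exact (lengthAt_torsion_quotient_le_of_smul_le N₀ N hle 𝔭 hs hsN).trans
    (lengthAt_torsion_quotient_map_le_torsion loc toX hexact J hJ 𝔭 hcoker)

end LocalAlgebra

/-! ### §2 The mass skeleton with `𝔭`-local cyclicity -/

section MassSkeleton

variable {R : Type*} [CommRing R] [IsDomain R] [UniqueFactorizationMonoid R]
  {H P X Y Ds Df : Type*} [AddCommGroup H] [Module R H] [AddCommGroup P] [Module R P] [AddCommGroup X] [Module R X]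
  [AddCommGroup Y] [Module R Y] [AddCommGroup Ds] [Module R Ds] [AddCommGroup Df] [Module R Df]

/-- **THE MASS SKELETON WITH `𝔭`-LOCAL CYCLICITY** — `min_lengthAt_le_fine_add_torsion_of_massSkeleton` (w2 g9) with its hypothesis
«`H = R·h₀`» weakened to «`s·H ⊆ R·h₀` for some `s ∉ 𝔭`» (`hs`, `hcyc`): data `loc : H → P` with `loc h₀ ≠ 0`, `toX : P → X` exact at `P`
(Poitou–Tate), `πY : X ↠ Y` with `ker πY = range toX`, the joint Coleman map `J : P ↪ R²` with `ℓ_𝔭(R²/range J) = 0`, the chromatic duals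
`π• : X ↠ D•` with `ker π• = toX(ker(•-coordinate of J))`. THEN `min(ℓ_𝔭 D♯, ℓ_𝔭 D♭) ≤ ℓ_𝔭 Y + ℓ_𝔭(tors X)`. Proof = the skeleton's,
with §1's `𝔭`-local lemmas in place of the two cyclic ones. [cite: Kato2004Asterisque, (17.13.1) (p. 280)] [cite: Kobayashi2003, Prop. 7.1 and Thm. 7.3 (pp. 12–13)]
[cite: Sprung2012, Def. 7.9, 7.11 (p. 1503), Def. 7.13 (p. 1504), §7.1 Props. 7.3/7.6] [cite: KuriharaPollack2007, Prop. 1.2] [cite: BourbakiAC5to7, VII §4.4] -/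
theorem min_lengthAt_le_fine_add_torsion_of_massSkeleton_of_smul
    (loc : H →ₗ[R] P) (toX : P →ₗ[R] X) (hexact : Function.Exact loc toX)
    (J : P →ₗ[R] R × R) (hJ : Function.Injective J)
    (πY : X →ₗ[R] Y) (hπY : Function.Surjective πY) (hkerY : LinearMap.ker πY = LinearMap.range toX)
    (πs : X →ₗ[R] Ds) (hπs : Function.Surjective πs)
    (hkers : LinearMap.ker πs = (LinearMap.ker (LinearMap.fst R R R ∘ₗ J)).map toX)
    (πf : X →ₗ[R] Df) (hπf : Function.Surjective πf)
    (hkerf : LinearMap.ker πf = (LinearMap.ker (LinearMap.snd R R R ∘ₗ J)).map toX)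
    (h₀ : H) {s : R} (hloc : loc h₀ ≠ 0)
    (𝔭 : PrimeSpectrum R) (h𝔭 : 𝔭.asIdeal.height = 1) (hs : s ∉ 𝔭.asIdeal) (hcyc : ∀ h : H, ∃ r : R, s • h = r • h₀)
    (hcoker : Module.lengthAt R ((R × R) ⧸ LinearMap.range J) 𝔭 = 0) :
    min (Module.lengthAt R Ds 𝔭) (Module.lengthAt R Df 𝔭) ≤
      Module.lengthAt R Y 𝔭 + Module.lengthAt R (Submodule.torsion R X) 𝔭 := by
  -- the two coordinates of `v₀ = J (loc h₀)`
  set cs : P →ₗ[R] R := LinearMap.fst R R R ∘ₗ J with hcs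
  set cf : P →ₗ[R] R := LinearMap.snd R R R ∘ₗ J with hcf
  set a : R := cs (loc h₀) with ha
  set b : R := cf (loc h₀) with hb
  have hv₀ : J (loc h₀) = (a, b) := Prod.ext rfl rfl
  have hv₀ne : J (loc h₀) ≠ 0 := fun h => hloc (hJ (by rw [h, map_zero]))
  -- cokernels of the coordinates have length `0`
  have hcs0 : Module.lengthAt R (R ⧸ LinearMap.range cs) 𝔭 = 0 :=
    nonpos_iff_eq_zero.mp ((lengthAt_quotient_range_comp_le J _ Prod.fst_surjective 𝔭).trans hcoker.le)
  have hcf0 : Module.lengthAt R (R ⧸ LinearMap.range cf) 𝔭 = 0 :=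
    nonpos_iff_eq_zero.mp ((lengthAt_quotient_range_comp_le J _ Prod.snd_surjective 𝔭).trans hcoker.le)
  -- `ℓ D• ≤ ℓ R/(a•) + ℓ Y`
  have hDs : Module.lengthAt R Ds 𝔭 ≤ Module.lengthAt R (R ⧸ Ideal.span {a}) 𝔭 + Module.lengthAt R Y 𝔭 := by
    have h1 := lengthAt_le_range_comp_add_of_ker_eq_range toX πs hπs πY hπY hkerY 𝔭
    rwa [lengthAt_range_comp_eq_of_ker_eq_map loc toX hexact πs _ hkers 𝔭,
      lengthAt_quotient_ker_sup_range_eq_of_smul loc cs h₀ 𝔭 hs hcyc hcs0] at h1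
  have hDf : Module.lengthAt R Df 𝔭 ≤ Module.lengthAt R (R ⧸ Ideal.span {b}) 𝔭 + Module.lengthAt R Y 𝔭 := by
    have h1 := lengthAt_le_range_comp_add_of_ker_eq_range toX πf hπf πY hπY hkerY 𝔭
    rwa [lengthAt_range_comp_eq_of_ker_eq_map loc toX hexact πf _ hkerf 𝔭,
      lengthAt_quotient_ker_sup_range_eq_of_smul loc cf h₀ 𝔭 hs hcyc hcf0] at h1
  have htors := lengthAt_torsion_span_quotient_le_torsion_of_smul loc toX hexact J hJ h₀ 𝔭 hs hcyc hcoker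
  rw [hv₀] at htors
  -- `min(ℓ R/(a), ℓ R/(b)) ≤ ℓ tors(R²/R·(a,b))`, in all cases
  have hmin : min (Module.lengthAt R (R ⧸ Ideal.span {a}) 𝔭) (Module.lengthAt R (R ⧸ Ideal.span {b}) 𝔭) ≤
      Module.lengthAt R (Submodule.torsion R ((R × R) ⧸ Submodule.span R {((a, b) : R × R)})) 𝔭 := by
    by_cases ha0 : a = 0
    · have hb0 : b ≠ 0 := by
        rintro hb0
        exact hv₀ne (by rw [hv₀, ha0, hb0]; rfl)
      rw [ha0]
      exact (min_le_right _ _).trans (lengthAt_quotient_span_le_torsion_pair_snd hb0 𝔭)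
    by_cases hb0 : b = 0
    · rw [hb0]
      exact (min_le_left _ _).trans (lengthAt_quotient_span_le_torsion_pair_fst ha0 𝔭)
    exact (lengthAt_torsion_quotient_span_pair_eq_min a b ha0 hb0 𝔭 h𝔭).ge
  calc min (Module.lengthAt R Ds 𝔭) (Module.lengthAt R Df 𝔭)
      ≤ min (Module.lengthAt R (R ⧸ Ideal.span {a}) 𝔭 + Module.lengthAt R Y 𝔭)
          (Module.lengthAt R (R ⧸ Ideal.span {b}) 𝔭 + Module.lengthAt R Y 𝔭) := min_le_min hDs hDf
    _ = min (Module.lengthAt R (R ⧸ Ideal.span {a}) 𝔭) (Module.lengthAt R (R ⧸ Ideal.span {b}) 𝔭) +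
          Module.lengthAt R Y 𝔭 := min_add_add_right _ _ _
    _ ≤ Module.lengthAt R (Submodule.torsion R X) 𝔭 + Module.lengthAt R Y 𝔭 := add_le_add (hmin.trans htors) le_rfl
    _ = Module.lengthAt R Y 𝔭 + Module.lengthAt R (Submodule.torsion R X) 𝔭 := add_comm _ _

end MassSkeleton

/-! ### §3 `𝔭`-local cyclicity is automatic for a submodule of a UFD at a height-one prime -/

section LocallyCyclic

variable {R : Type*} [CommRing R] [IsDomain R] [UniqueFactorizationMonoid R]
  {H : Type*} [AddCommGroup H] [Module R H]

/-- **A non-zero ideal of a UFD is `𝔭`-locally principal at every height-one prime `𝔭`, on one of its own elements**: for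
`J ≤ R` with `J ≠ 0` and `𝔭 = (π)` of height one there are `a₀ ∈ J`, `a₀ ≠ 0`, and `s ∉ 𝔭` with `s·J ⊆ R·a₀`. Take `a₀` of least
`π`-multiplicity `v` among the non-zero elements of `J`, `a₀ = π^v·s`, `π ∤ s`: every `x = π^n·y ∈ J` (`π ∤ y`, so `n ≥ v`) has
`s·x = (π^{n−v}·y)·a₀`. [folklore] [cite: BourbakiAC5to7, VII §3 (factorial rings), VII §4.4] -/
theorem Ideal.exists_mem_smul_le_span_singleton_of_height_eq_one (J : Ideal R) (hJ : J ≠ ⊥)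
    (𝔭 : PrimeSpectrum R) (h𝔭 : 𝔭.asIdeal.height = 1) :
    ∃ a₀ ∈ J, a₀ ≠ 0 ∧ ∃ s : R, s ∉ 𝔭.asIdeal ∧ ∀ x ∈ J, ∃ r : R, s * x = r * a₀ := by
  -- `𝔭 = (π)`, `π ≠ 0` not a unit
  obtain ⟨π, hπ'⟩ := UniqueFactorizationMonoid.isPrincipal_of_height_eq_one h𝔭
  have hπ : 𝔭.asIdeal = Ideal.span {π} := hπ'
  have hπu : ¬ IsUnit π := by
    intro hu
    apply 𝔭.isPrime.ne_top
    rw [hπ, Ideal.span_singleton_eq_top]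
    exact hu
  have hπ0 : π ≠ 0 := by
    rintro rfl
    exact 𝔭.asIdeal.ne_bot_of_height_eq_one h𝔭 (by rw [hπ, Ideal.span_singleton_eq_bot])
  -- the set of `π`-exponents of non-zero elements of `J` is non-empty
  have hex : ∃ n : ℕ, ∃ x ∈ J, ∃ y : R, ¬ π ∣ y ∧ x = π ^ n * y := by
    obtain ⟨x, hxJ, hx0⟩ := J.ne_bot_iff.mp hJ
    obtain ⟨n, y, hy, rfl⟩ := WfDvdMonoid.max_power_factor' hx0 hπu
    exact ⟨n, _, hxJ, y, hy, rfl⟩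
  classical
  set v : ℕ := Nat.find hex with hv
  obtain ⟨a₀, ha₀J, y₀, hy₀, ha₀⟩ := Nat.find_spec hex
  refine ⟨a₀, ha₀J, ?_, y₀, ?_, ?_⟩
  · rw [ha₀]
    exact mul_ne_zero (pow_ne_zero _ hπ0) (fun h0 => hy₀ (by rw [h0]; exact dvd_zero π))
  · rw [hπ, Ideal.mem_span_singleton]
    exact hy₀
  · intro x hxJ
    by_cases hx0 : x = 0
    · exact ⟨0, by rw [hx0, mul_zero, zero_mul]⟩
    obtain ⟨n, y, hy, rfl⟩ := WfDvdMonoid.max_power_factor' hx0 hπu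
    have hvn : v ≤ n := Nat.find_min' hex ⟨_, hxJ, y, hy, rfl⟩
    refine ⟨π ^ (n - v) * y, ?_⟩
    rw [ha₀]
    change y₀ * (π ^ n * y) = π ^ (n - Nat.find hex) * y * (π ^ Nat.find hex * y₀)
    rw [← hv]
    have hn : n = (n - v) + v := (Nat.sub_add_cancel hvn).symm
    conv_lhs => rw [hn, pow_add]
    ring

/-- **An `R`-module that embeds into the UFD `R` is `𝔭`-locally cyclic at every height-one prime, on a non-zero element**: if
`φ : H → R` is an INJECTIVE linear map and `H ≠ 0`, then for every `𝔭` of height one there are `h₀ ∈ H`, `h₀ ≠ 0`, and `s ∉ 𝔭` with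
`∀ h, ∃ r, s·h = r·h₀` (pull `Ideal.exists_mem_smul_le_span_singleton_of_height_eq_one` for `J = φ(H)` back along `φ`). Reading: Kato's
`𝐇¹_Γ(T_pW)` embedded in `Λ` by a signed Coleman map is `𝔭`-locally cyclic without knowing that it is free.
[folklore] [cite: BourbakiAC5to7, VII §4.4] [cite: Kato2004Asterisque, Thm. 12.4 (p. 221) (the statement this replaces in the ι-door)] -/
theorem exists_smul_cyclic_of_injective (φ : H →ₗ[R] R) (hφ : Function.Injective φ) [Nontrivial H]
    (𝔭 : PrimeSpectrum R) (h𝔭 : 𝔭.asIdeal.height = 1) :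
    ∃ h₀ : H, h₀ ≠ 0 ∧ ∃ s : R, s ∉ 𝔭.asIdeal ∧ ∀ h : H, ∃ r : R, s • h = r • h₀ := by
  set J : Ideal R := LinearMap.range φ with hJ
  have hJ0 : J ≠ ⊥ := by
    obtain ⟨h, hh⟩ := exists_ne (0 : H)
    intro hbot
    apply hh
    apply hφ
    rw [map_zero]
    have : φ h ∈ J := ⟨h, rfl⟩
    rw [hbot] at this
    exact (Submodule.mem_bot R).mp this
  obtain ⟨a₀, ⟨h₀, rfl⟩, ha₀, s, hs, hJs⟩ := Ideal.exists_mem_smul_le_span_singleton_of_height_eq_one J hJ0 𝔭 h𝔭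
  refine ⟨h₀, fun h0 => ha₀ (by rw [h0, map_zero]), s, hs, fun h => ?_⟩
  obtain ⟨r, hr⟩ := hJs (φ h) ⟨h, rfl⟩
  refine ⟨r, hφ ?_⟩
  rw [map_smul, map_smul, smul_eq_mul, smul_eq_mul, hr]

end LocallyCyclic

end Summit.BirchSwinnertonDyer.BirchSwinnertonDyer.Theorems.ChromaticCommonZeros

end
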